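import Summits.QuantumFields.BalabanUV.Beta.FP.RelInvPeriodisedCombRows

/-!
# `BalabanUV.Beta.FP.RelInvPeriodisedCoarse` — road «FP» (binder row D1), ROUTE T row **(T-INV)**, THE SECOND (INV) LETTER AS A TRANSFER:
# `det kkt (𝔊₁₁ + G₀) [Q₂₀; τ₂] ≠ 0` FROM THE DICTIONARY'S IDENTIFICATION OF THE COARSE SLICED SYSTEM WITH THE PRESENTED LEVEL-`k`
# ONE-STEP SYSTEM ON THE COARSE TORUS (`k = j+1` at the consumer), DISPLAYED AS THREE HYPOTHESES `hId ∕ hQ ∕ hτ`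

HONEST DEPENDENCY (page 1, mandatory): continuum YM on T⁴ ⇐ BetaPertH ∧ nine spine estimates (0/9 proved); BetaPertH ⇐ (D1) ∧ (D4) ∧
CAP+tail; G-an2-4 gates asym, D1 and NE2/3/4.  HONEST FRAMING (cell contract, verbatim): «discharging `BetaPertH` makes Bałaban's UV
stability UNCONDITIONAL — a real constructive-QFT result; it is NOT the continuum limit and NOT the Clay problem.»  ABSOLUTE RULE (cell
charter, verbatim): «No internally-minted statement may enter as a cited fact. Every hypothesis is either kernel-proved in this package or a
verbatim quotation of a PUBLISHED theorem with page reference. The manuscript(s) under audit are NOT citable for their own disputed steps — they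
are the thing under adjudication; programme-internal (2001/route/tribunal) claims are never citable.»  THIS MODULE is [folklore] bookkeeping BY
NAME over leaf-05's `RelInvPeriodisedCombRows.torus_isUnit_det_kkt_combRows` (p310903, the FIRST (INV) letter at the comb chart of record, every
level) and `RelInvPeriodisedSliced` §1 (`det_kkt_submatrix_equiv`, `det_kkt_fromRows_mul_mul`, p309426); it mints no `Prop`, has no `def`, cites
nothing, 0 sorry.  «not in print; our bookkeeping».

WHY (OWNER d1-p3 g17, WORD W-FP-17-9, journal l.38109; `TID-LETTER-SPEC.md` § B (iv)).  Binder `h2` of `NestedStepLawOneShotJets.secondVar_oneShot_nestedStepLaw_jets(_of_uni)`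
(p308750) ∕ `NestedStepLawOneShotLetters` (p311088) reads `(kkt (S.toBlocks₁₁ + G₀) (fromRows Q₂₀ τ₂)).det ≠ 0` — the COARSE sliced system: `S = effForm H₀ [Q₁₀;τ₁]`
(the effective form of the fine sliced step), `G₀` the block term, `Q₂₀` the coarse one-step averaging rows, `τ₂` the coarse comb slice.  By the OWNER's W-FP-17-8 (C)
`Q₂₀`, `τ₂` ARE the level-`(j+1)` one-step rows ∕ comb rows on the coarse torus `M'` (root `r'`), and the dictionary (Q-FP-16-5, an2) owes the identification of the
FORM slot `S.toBlocks₁₁ + G₀` with the presented level-`(j+1)` field block up to a non-zero scalar — the torus instance of «iterated effective form = one-shot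
effective form at the next blocking» (`CompositionSingular.effForm_compForm` shape).  THIS FILE is the slot that identification plugs into: with the three
equations DISPLAYED as hypotheses, `h2` follows from the first (INV) letter at level `k` on `M'`.  Nothing of the identification is asserted here.

CONTENT.
* §1 (generic, any field): `kkt_smul_form_mul` ∕ **`det_kkt_smul_form`** (`det kkt (c•H) Q · c^{#rows} = c^{#fields} · det kkt H Q` — scaling the FORM block only),
  `det_kkt_smul_form_ne_zero_iff` (`c ≠ 0`); **`det_kkt_fromRows_submatrix_equiv`** (re-index the fields along `e` and the slice rows
  along `eρ`, averaging rows untouched: same determinant).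
* §2 `exists_fieldSlot_equiv`: an injective, field-valued presentation `fν' : μ → Idx M' (Fib d)` hitting EVERY field slot is `fieldSlot ∘ e` for an `e : μ ≃ ↥(pbox M') × Fin (d+1)`.
* §3 THE TRANSFER, every `d`, in-block coarse root `r'`, `Lc ≥ 1`, every level `k`, every coarse box `M'` with `Lc ∣ M'_i`, ANY injective coarse-multiplier presentation
  `fμ'` (as in p310903: `inr`-valued, range = the multiplier slots at the `Lc`-coarse sites of `M'`):
  **`coarse_det_kkt_ne_zero_fieldSlot`** (fields presented by `fieldSlot ∘ e`, `e : μ ≃ ↥(pbox M') × Fin (d+1)`; slice rows by `eρ : ρ₂ ≃ Res (toSite r') Lc M'`;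
  `hId : F = c • P̂.submatrix fν fν`, `hQ : Q₂₀ = P̂.submatrix fμ' fν`, `hτ : τ₂ = (combRowsT (toSite r') Lc M').submatrix eρ fν`, `c ≠ 0`, `P̂ := perF M' (bhKStepAt d (toSite r') Lc k)`
  ⇒ `(kkt F (fromRows Q₂₀ τ₂)).det ≠ 0`), **`coarse_det_kkt_ne_zero`** (the same for ANY injective field presentation `fν' : μ → Idx M' (Fib d)` onto the field slots),
  **`coarse_det_kkt_ne_zero_mul`** (averaging rows recombined by any `S` with `det S ≠ 0` — e.g. a border scale — and slice rows by any `T` with `det T ≠ 0` — signs ∕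
  permutations of the comb rows), **`coarse_det_kkt_ne_zero_record`** (at the index types of record of the OWNER's `NestedStepLawTorusInstance`: fields
  `↥(pbox M') × Fin (d+1)` read by `(s, α) ↦ (s, inl α)`, slice rows `Res (toSite r') Lc M'`, no re-indexing), `coarse_isUnit_det_kkt` (`IsUnit` currency).
USE (the OWNER's `NestedStepLawTorusInstance`, INTENT I-FP-17-8): `h2 := coarse_det_kkt_ne_zero_record M' hr' hM' (j+1) fμ' hfμ' hμ' hcoarse' hc hId hQ hτ` with
`F := S.toBlocks₁₁ + G₀` (or `coarse_det_kkt_ne_zero …` for another field presentation); the dictionary supplies `hId` alone (`hQ`, `hτ` are `rfl`-level readings of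
the instance's own presentations).
WHAT IT IS NOT: NOT the identification `hId` (Q-FP-16-5), NOT the converse transfer (NOT NOW, W-FP-17-9 (α)), NOT (T-ID), NOT SDF, NOT D1, NOT BetaPertH, NOT continuum,
NOT Clay; discharges NO binder of row D1 by itself; 0 estimates.  Unit `b2b-balaban-beta-d1-formalise-leaf-05` (gen 25), 2026-08-22.  No existing file touched.
-/

noncomputable section

open scoped BigOperators Matrix

namespace Summit.QuantumFields.BalabanUV.Beta.FP.RelInvPeriodisedCoarse

open Matrix
open Literature.Probability.LatticeModels (Torus.proj)
open Literature.MathematicalPhysics.QuantumFieldTheory.Balaban1983to89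
open Literature.MathematicalPhysics.QuantumFieldTheory.Balaban1983to89.Beta
open Literature.MathematicalPhysics.QuantumFieldTheory.Balaban1983to89.Beta.Composition (kkt)
open B6Lemma24Torus (pbox)
open AffineAveraging (Site box toSite)
open OneStepResolventKernel (Fib)
open Summit.QuantumFields.BalabanUV.Beta.BorderedHessian (bhKStepAt)
open Summit.QuantumFields.BalabanUV.Beta.FP.KernelPeriodisationFib (Idx perF)
open Summit.QuantumFields.BalabanUV.Beta.FP.TorusCombRows (Res combRowsT)
open Summit.QuantumFields.BalabanUV.Beta.FP.RelInvPeriodisedSliced (det_kkt_submatrix_equiv det_kkt_fromRows_mul_mul)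
open Summit.QuantumFields.BalabanUV.Beta.FP.RelInvPeriodisedCombRows (torus_isUnit_det_kkt_combRows)

/-! ## §1 Generic linear algebra: a scalar on the form block; re-indexing fields and slice rows -/

section Generic

variable {𝕜 : Type*} [Field 𝕜]
variable {ν ν' κ ρ ρ' : Type*} [Fintype ν] [Fintype ν'] [Fintype κ] [Fintype ρ] [Fintype ρ']
  [DecidableEq ν] [DecidableEq ν'] [DecidableEq κ] [DecidableEq ρ] [DecidableEq ρ']

/-- [folklore] Scaling the FORM block is a two-sided block-diagonal conjugation up to the scalar: `kkt (c•H) Q · diag(1, c) = diag(c, 1) · kkt H Q`. -/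
theorem kkt_smul_form_mul (c : 𝕜) (H : Matrix ν ν 𝕜) (Q : Matrix κ ν 𝕜) :
    kkt (c • H) Q * fromBlocks (1 : Matrix ν ν 𝕜) 0 0 (c • (1 : Matrix κ κ 𝕜))
      = fromBlocks (c • (1 : Matrix ν ν 𝕜)) 0 0 (1 : Matrix κ κ 𝕜) * kkt H Q := by
  simp only [kkt, fromBlocks_multiply, Matrix.mul_one, Matrix.mul_zero, Matrix.zero_mul, Matrix.one_mul, add_zero, zero_add,
    Matrix.mul_smul, Matrix.smul_mul, smul_zero]

/-- [folklore] **`det kkt (c•H) Q · c^{#κ} = c^{#ν} · det kkt H Q`** — scaling the form block multiplies the bordered determinant by `c^{#ν − #κ}`. -/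
theorem det_kkt_smul_form (c : 𝕜) (H : Matrix ν ν 𝕜) (Q : Matrix κ ν 𝕜) :
    (kkt (c • H) Q).det * c ^ Fintype.card κ = c ^ Fintype.card ν * (kkt H Q).det := by
  have h := congrArg Matrix.det (kkt_smul_form_mul c H Q)
  simpa only [det_mul, det_fromBlocks_zero₂₁, det_one, one_mul, mul_one, det_smul] using h

/-- [folklore] Hence for `c ≠ 0`: `det kkt (c•H) Q ≠ 0 ↔ det kkt H Q ≠ 0`. -/
theorem det_kkt_smul_form_ne_zero_iff {c : 𝕜} (hc : c ≠ 0) (H : Matrix ν ν 𝕜) (Q : Matrix κ ν 𝕜) :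
    (kkt (c • H) Q).det ≠ 0 ↔ (kkt H Q).det ≠ 0 := by
  have h := det_kkt_smul_form c H Q
  constructor
  · intro h1 h0
    rw [h0, mul_zero] at h
    exact mul_ne_zero h1 (pow_ne_zero _ hc) h
  · intro h1 h0
    rw [h0, zero_mul] at h
    exact mul_ne_zero (pow_ne_zero _ hc) h1 h.symm

/-- [folklore] **RE-INDEXING THE FIELDS ALONG `e` AND THE SLICE ROWS ALONG `eρ` (averaging rows untouched) DOES NOT CHANGE THE SLICED DETERMINANT.** -/
theorem det_kkt_fromRows_submatrix_equiv (H : Matrix ν ν 𝕜) (Q : Matrix κ ν 𝕜) (τ : Matrix ρ ν 𝕜) (e : ν' ≃ ν) (eρ : ρ' ≃ ρ) :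
    (kkt (H.submatrix e e) (fromRows (Q.submatrix id e) (τ.submatrix eρ e))).det = (kkt H (fromRows Q τ)).det := by
  classical
  have h : fromRows (Q.submatrix id e) (τ.submatrix eρ e) = (fromRows Q τ).submatrix (Equiv.sumCongr (Equiv.refl κ) eρ) e := by
    ext (i | i) j <;> rfl
  rw [h, det_kkt_submatrix_equiv]

end Generic

/-! ## §2 Field-slot presentations of the coarse box -/

section Torus

variable {d : ℕ} {Lc : ℕ} [NeZero Lc] {r' : Fin (d + 1) → ℕ} (M' : Fin (d + 1) → ℕ) [∀ i, NeZero (M' i)]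

omit [NeZero Lc] [∀ i, NeZero (M' i)] in
/-- [folklore] **AN INJECTIVE FIELD PRESENTATION ONTO THE FIELD SLOTS IS `fieldSlot ∘ e`.**  For `fν' : μ → Idx M' (Fib d)` injective, `inl`-valued and hitting
every field slot `(s, inl α)` there is `e : μ ≃ ↥(pbox M') × Fin (d+1)` with `((e b).1, inl (e b).2) = fν' b`. -/
theorem exists_fieldSlot_equiv {μ : Type*} (fν' : μ → Idx M' (Fib d)) (hfν' : Function.Injective fν')
    (hν' : ∀ b, ∃ α : Fin (d + 1), (fν' b).2 = Sum.inl α)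
    (hfield : ∀ (s : ↥(pbox M')) (α : Fin (d + 1)), ((s, Sum.inl α) : Idx M' (Fib d)) ∈ Set.range fν') :
    ∃ e : μ ≃ ↥(pbox M') × Fin (d + 1), ∀ b, (((e b).1, Sum.inl (e b).2) : Idx M' (Fib d)) = fν' b := by
  let g : μ → ↥(pbox M') × Fin (d + 1) := fun b => ((fν' b).1, Sum.elim id id (fν' b).2)
  have hg : ∀ b, (((g b).1, Sum.inl (g b).2) : Idx M' (Fib d)) = fν' b := by
    intro b
    obtain ⟨α, hα⟩ := hν' b
    refine Prod.ext rfl ?_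
    show Sum.inl (Sum.elim id id (fν' b).2) = (fν' b).2
    rw [hα]; rfl
  have hinj : Function.Injective g := fun b b' h => hfν' (by rw [← hg b, ← hg b', h])
  have hsurj : Function.Surjective g := by
    rintro ⟨s, α⟩
    obtain ⟨b, hb⟩ := hfield s α
    refine ⟨b, ?_⟩
    have h := hg b
    rw [hb] at h
    have h1 : (g b).1 = s := congrArg Prod.fst h
    have h2 : (Sum.inl (g b).2 : Fib d) = Sum.inl α := congrArg Prod.snd h
    exact Prod.ext h1 (Sum.inl_injective h2)
  exact ⟨Equiv.ofBijective g ⟨hinj, hsurj⟩, fun b => hg b⟩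

/-! ## §3 The transfer: the SECOND (INV) letter from the displayed identification -/

set_option synthInstance.maxSize 1024 in
/-- **[folklore] (INV)-2 AS A TRANSFER, FIELD-SLOT FORM.**  Fields of the coarse sliced system presented by `fieldSlot ∘ e` (`e : μ ≃ ↥(pbox M') × Fin (d+1)`), slice rows
by `eρ : ρ₂ ≃ Res (toSite r') Lc M'`, averaging rows by any injective coarse-multiplier presentation `fμ'` of `M'` (`inr`-valued, range = the multiplier slots at the
`Lc`-coarse sites); `P̂ := perF M' (bhKStepAt d (toSite r') Lc k)`.  IF `F = c • P̂.submatrix fν fν` (`c ≠ 0`), `Q₂₀ = P̂.submatrix fμ' fν`, `τ₂ = (combRowsT (toSite r') Lc M').submatrix eρ fν`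
THEN `det kkt F [Q₂₀; τ₂] ≠ 0` — by `torus_isUnit_det_kkt_combRows` at `(M', r', k)`, §1.  At the consumer `F := S.toBlocks₁₁ + G₀`, `k := j + 1`. -/
theorem coarse_det_kkt_ne_zero_fieldSlot (hr' : r' ∈ box (d + 1) Lc) (hM' : ∀ i, Lc ∣ M' i) (k : ℕ)
    {κ : Type*} [Fintype κ] [DecidableEq κ] (fμ' : κ → Idx M' (Fib d)) (hfμ' : Function.Injective fμ')
    (hμ' : ∀ a : κ, ∃ m : Fin (d + 1), (fμ' a).2 = Sum.inr m)
    (hcoarse' : ∀ (s : ↥(pbox M')) (m : Fin (d + 1)), ((s, Sum.inr m) : Idx M' (Fib d)) ∈ Set.range fμ' ↔ Torus.proj Lc (s : Site (d + 1)) = 0)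
    {μ ρ₂ : Type*} [Fintype μ] [DecidableEq μ] [Fintype ρ₂] [DecidableEq ρ₂]
    (e : μ ≃ ↥(pbox M') × Fin (d + 1)) (eρ : ρ₂ ≃ Res (toSite r') Lc M') {c : ℝ} (hc : c ≠ 0)
    {F : Matrix μ μ ℝ} {Q₂₀ : Matrix κ μ ℝ} {τ₂ : Matrix ρ₂ μ ℝ}
    (hId : F = c • (perF M' (bhKStepAt d (toSite r') Lc k)).submatrix
      (fun b : μ => (((e b).1, Sum.inl (e b).2) : Idx M' (Fib d))) (fun b : μ => (((e b).1, Sum.inl (e b).2) : Idx M' (Fib d))))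
    (hQ : Q₂₀ = (perF M' (bhKStepAt d (toSite r') Lc k)).submatrix fμ' (fun b : μ => (((e b).1, Sum.inl (e b).2) : Idx M' (Fib d))))
    (hτ : τ₂ = (combRowsT (toSite r') Lc M').submatrix eρ (fun b : μ => (((e b).1, Sum.inl (e b).2) : Idx M' (Fib d)))) :
    (kkt F (fromRows Q₂₀ τ₂)).det ≠ 0 := by
  subst hId hQ hτ
  have key := (torus_isUnit_det_kkt_combRows M' hr' hM' k fμ' hfμ' hμ' hcoarse').ne_zero
  set P := perF M' (bhKStepAt d (toSite r') Lc k) with hP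
  set fs : ↥(pbox M') × Fin (d + 1) → Idx M' (Fib d) := fun b => (b.1, Sum.inl b.2) with hfs
  change (kkt (c • (P.submatrix fs fs).submatrix e e)
    (fromRows ((P.submatrix fμ' fs).submatrix id e) (((combRowsT (toSite r') Lc M').submatrix id fs).submatrix eρ e))).det ≠ 0
  rw [det_kkt_smul_form_ne_zero_iff hc, det_kkt_fromRows_submatrix_equiv]
  exact key

set_option synthInstance.maxSize 1024 in
/-- **[folklore] (INV)-2 AS A TRANSFER — ANY INJECTIVE FIELD PRESENTATION ONTO THE FIELD SLOTS.**  As `coarse_det_kkt_ne_zero_fieldSlot` with the fields of the coarse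
sliced system presented by any `fν' : μ → Idx M' (Fib d)` injective, `inl`-valued, onto the field slots of the coarse box (§2).  The three equations `hId ∕ hQ ∕ hτ` are the
dictionary's identification, DISPLAYED; `hId` is Q-FP-16-5's. -/
theorem coarse_det_kkt_ne_zero (hr' : r' ∈ box (d + 1) Lc) (hM' : ∀ i, Lc ∣ M' i) (k : ℕ)
    {κ : Type*} [Fintype κ] [DecidableEq κ] (fμ' : κ → Idx M' (Fib d)) (hfμ' : Function.Injective fμ')
    (hμ' : ∀ a : κ, ∃ m : Fin (d + 1), (fμ' a).2 = Sum.inr m)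
    (hcoarse' : ∀ (s : ↥(pbox M')) (m : Fin (d + 1)), ((s, Sum.inr m) : Idx M' (Fib d)) ∈ Set.range fμ' ↔ Torus.proj Lc (s : Site (d + 1)) = 0)
    {μ ρ₂ : Type*} [Fintype μ] [DecidableEq μ] [Fintype ρ₂] [DecidableEq ρ₂]
    (fν' : μ → Idx M' (Fib d)) (hfν' : Function.Injective fν') (hν' : ∀ b, ∃ α : Fin (d + 1), (fν' b).2 = Sum.inl α)
    (hfield : ∀ (s : ↥(pbox M')) (α : Fin (d + 1)), ((s, Sum.inl α) : Idx M' (Fib d)) ∈ Set.range fν')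
    (eρ : ρ₂ ≃ Res (toSite r') Lc M') {c : ℝ} (hc : c ≠ 0)
    {F : Matrix μ μ ℝ} {Q₂₀ : Matrix κ μ ℝ} {τ₂ : Matrix ρ₂ μ ℝ}
    (hId : F = c • (perF M' (bhKStepAt d (toSite r') Lc k)).submatrix fν' fν')
    (hQ : Q₂₀ = (perF M' (bhKStepAt d (toSite r') Lc k)).submatrix fμ' fν')
    (hτ : τ₂ = (combRowsT (toSite r') Lc M').submatrix eρ fν') :
    (kkt F (fromRows Q₂₀ τ₂)).det ≠ 0 := by
  obtain ⟨e, he⟩ := exists_fieldSlot_equiv M' fν' hfν' hν' hfield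
  have hfe : (fun b : μ => (((e b).1, Sum.inl (e b).2) : Idx M' (Fib d))) = fν' := funext he
  subst hfe
  exact coarse_det_kkt_ne_zero_fieldSlot M' hr' hM' k fμ' hfμ' hμ' hcoarse' e eρ hc hId hQ hτ

set_option synthInstance.maxSize 1024 in
/-- **[folklore] (INV)-2 AS A TRANSFER, WITH RECOMBINED ROWS.**  As `coarse_det_kkt_ne_zero`, the averaging rows recombined by any `S` with `det S ≠ 0` (e.g. a border scale
`s • 1`) and the slice rows by any `T` with `det T ≠ 0` (signs ∕ permutations ∕ recombinations of the comb rows): `det kkt F [S·Q̂; T·τ̂] = (det S · det T)² · det kkt F [Q̂; τ̂] ≠ 0`. -/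
theorem coarse_det_kkt_ne_zero_mul (hr' : r' ∈ box (d + 1) Lc) (hM' : ∀ i, Lc ∣ M' i) (k : ℕ)
    {κ : Type*} [Fintype κ] [DecidableEq κ] (fμ' : κ → Idx M' (Fib d)) (hfμ' : Function.Injective fμ')
    (hμ' : ∀ a : κ, ∃ m : Fin (d + 1), (fμ' a).2 = Sum.inr m)
    (hcoarse' : ∀ (s : ↥(pbox M')) (m : Fin (d + 1)), ((s, Sum.inr m) : Idx M' (Fib d)) ∈ Set.range fμ' ↔ Torus.proj Lc (s : Site (d + 1)) = 0)
    {μ ρ₂ : Type*} [Fintype μ] [DecidableEq μ] [Fintype ρ₂] [DecidableEq ρ₂]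
    (fν' : μ → Idx M' (Fib d)) (hfν' : Function.Injective fν') (hν' : ∀ b, ∃ α : Fin (d + 1), (fν' b).2 = Sum.inl α)
    (hfield : ∀ (s : ↥(pbox M')) (α : Fin (d + 1)), ((s, Sum.inl α) : Idx M' (Fib d)) ∈ Set.range fν')
    (eρ : ρ₂ ≃ Res (toSite r') Lc M') {c : ℝ} (hc : c ≠ 0)
    (S : Matrix κ κ ℝ) (T : Matrix ρ₂ ρ₂ ℝ) (hS : S.det ≠ 0) (hT : T.det ≠ 0)
    {F : Matrix μ μ ℝ} {Q₂₀ : Matrix κ μ ℝ} {τ₂ : Matrix ρ₂ μ ℝ}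
    (hId : F = c • (perF M' (bhKStepAt d (toSite r') Lc k)).submatrix fν' fν')
    (hQ : Q₂₀ = S * (perF M' (bhKStepAt d (toSite r') Lc k)).submatrix fμ' fν')
    (hτ : τ₂ = T * (combRowsT (toSite r') Lc M').submatrix eρ fν') :
    (kkt F (fromRows Q₂₀ τ₂)).det ≠ 0 := by
  subst hQ hτ
  rw [det_kkt_fromRows_mul_mul]
  exact mul_ne_zero (pow_ne_zero _ (mul_ne_zero hS hT))
    (coarse_det_kkt_ne_zero M' hr' hM' k fμ' hfμ' hμ' hcoarse' fν' hfν' hν' hfield eρ hc hId rfl rfl)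

set_option synthInstance.maxSize 1024 in
/-- **[folklore] (INV)-2 AS A TRANSFER — AT THE INDEX TYPES OF RECORD** (the OWNER's `NestedStepLawTorusInstance`, INTENT I-FP-17-8: `μ := ↥(pbox M') × Fin (d+1)` the
coarse box's field slots read by `(s, α) ↦ (s, inl α)`, `ρ₂ := Res (toSite r') Lc M'`): no `e`, no `eρ` — `hId : F = c • P̂↾(fields, fields)`, `hQ : Q₂₀ = P̂↾(fμ', fields)`,
`hτ : τ₂ = (combRowsT (toSite r') Lc M')↾(id, fields)` ⇒ `det kkt F [Q₂₀; τ₂] ≠ 0`.  The consumer writes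
`h2 := coarse_det_kkt_ne_zero_record M' hr' hM' (j+1) fμ' hfμ' hμ' hcoarse' hc hId hQ hτ`. -/
theorem coarse_det_kkt_ne_zero_record (hr' : r' ∈ box (d + 1) Lc) (hM' : ∀ i, Lc ∣ M' i) (k : ℕ)
    {κ : Type*} [Fintype κ] [DecidableEq κ] (fμ' : κ → Idx M' (Fib d)) (hfμ' : Function.Injective fμ')
    (hμ' : ∀ a : κ, ∃ m : Fin (d + 1), (fμ' a).2 = Sum.inr m)
    (hcoarse' : ∀ (s : ↥(pbox M')) (m : Fin (d + 1)), ((s, Sum.inr m) : Idx M' (Fib d)) ∈ Set.range fμ' ↔ Torus.proj Lc (s : Site (d + 1)) = 0)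
    {c : ℝ} (hc : c ≠ 0)
    {F : Matrix (↥(pbox M') × Fin (d + 1)) (↥(pbox M') × Fin (d + 1)) ℝ} {Q₂₀ : Matrix κ (↥(pbox M') × Fin (d + 1)) ℝ}
    {τ₂ : Matrix (Res (toSite r') Lc M') (↥(pbox M') × Fin (d + 1)) ℝ}
    (hId : F = c • (perF M' (bhKStepAt d (toSite r') Lc k)).submatrix
      (fun b : ↥(pbox M') × Fin (d + 1) => ((b.1, Sum.inl b.2) : Idx M' (Fib d))) (fun b : ↥(pbox M') × Fin (d + 1) => ((b.1, Sum.inl b.2) : Idx M' (Fib d))))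
    (hQ : Q₂₀ = (perF M' (bhKStepAt d (toSite r') Lc k)).submatrix fμ' (fun b : ↥(pbox M') × Fin (d + 1) => ((b.1, Sum.inl b.2) : Idx M' (Fib d))))
    (hτ : τ₂ = (combRowsT (toSite r') Lc M').submatrix id (fun b : ↥(pbox M') × Fin (d + 1) => ((b.1, Sum.inl b.2) : Idx M' (Fib d)))) :
    (kkt F (fromRows Q₂₀ τ₂)).det ≠ 0 :=
  coarse_det_kkt_ne_zero_fieldSlot M' hr' hM' k fμ' hfμ' hμ' hcoarse' (Equiv.refl _) (Equiv.refl _) hc hId hQ hτ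

set_option synthInstance.maxSize 1024 in
/-- [folklore] `IsUnit` currency of `coarse_det_kkt_ne_zero`. -/
theorem coarse_isUnit_det_kkt (hr' : r' ∈ box (d + 1) Lc) (hM' : ∀ i, Lc ∣ M' i) (k : ℕ)
    {κ : Type*} [Fintype κ] [DecidableEq κ] (fμ' : κ → Idx M' (Fib d)) (hfμ' : Function.Injective fμ')
    (hμ' : ∀ a : κ, ∃ m : Fin (d + 1), (fμ' a).2 = Sum.inr m)
    (hcoarse' : ∀ (s : ↥(pbox M')) (m : Fin (d + 1)), ((s, Sum.inr m) : Idx M' (Fib d)) ∈ Set.range fμ' ↔ Torus.proj Lc (s : Site (d + 1)) = 0)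
    {μ ρ₂ : Type*} [Fintype μ] [DecidableEq μ] [Fintype ρ₂] [DecidableEq ρ₂]
    (fν' : μ → Idx M' (Fib d)) (hfν' : Function.Injective fν') (hν' : ∀ b, ∃ α : Fin (d + 1), (fν' b).2 = Sum.inl α)
    (hfield : ∀ (s : ↥(pbox M')) (α : Fin (d + 1)), ((s, Sum.inl α) : Idx M' (Fib d)) ∈ Set.range fν')
    (eρ : ρ₂ ≃ Res (toSite r') Lc M') {c : ℝ} (hc : c ≠ 0)
    {F : Matrix μ μ ℝ} {Q₂₀ : Matrix κ μ ℝ} {τ₂ : Matrix ρ₂ μ ℝ}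
    (hId : F = c • (perF M' (bhKStepAt d (toSite r') Lc k)).submatrix fν' fν')
    (hQ : Q₂₀ = (perF M' (bhKStepAt d (toSite r') Lc k)).submatrix fμ' fν')
    (hτ : τ₂ = (combRowsT (toSite r') Lc M').submatrix eρ fν') :
    IsUnit (kkt F (fromRows Q₂₀ τ₂)).det :=
  isUnit_iff_ne_zero.mpr (coarse_det_kkt_ne_zero M' hr' hM' k fμ' hfμ' hμ' hcoarse' fν' hfν' hν' hfield eρ hc hId hQ hτ)

end Torus

end Summit.QuantumFields.BalabanUV.Beta.FP.RelInvPeriodisedCoarse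

end
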